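/-
Origin: expansion seat `planner-pub-hodgecm-pv02-g3-0`, handover #11 2026-08-18T06:23:40Z (`HOME/pub-hodgecm-pv02-g3/lean/Pv02g3/PerL34/LineClass.lean`, md5 4c0a6034, 103 lines);
landed by the gen-6 packager in gate run 24 as `HodgeCM/PerL34/LineClass.lean` (stripped 1 #print/#check/#eval lines).
-/
/-
Origin: planner-pub-hodgecm-pv02-g3-0 (unit pub-hodgecm-pv02-g3, DAG-NODE PROVER #02 gen 3), 2026-08-18.
Proposed tree path: `HodgeCM/PerL34/LineClass.lean` (new, additive).  Imports LANDED `HodgeCM.PerL34.BallFrame` only.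
KERNEL: nothing cited, nothing asserted.
-/
import Summits.HodgeConjecture.HodgeCM.PerL34.BallFrame

/-!
# Line classes in `U(2,1)` (grouping step of `SplitHolForms.OrbitSpansDisjoint`)

If two elements `s, s'` of `U(2,1)` have proportional last rows (`s'₂ⱼ = λ s₂ⱼ`, i.e. the same pole line
`ℓ' = λ ℓ`), then `k := s' s⁻¹` is block-diagonal (`rows_of_sameClass`: the first two rows of `s'` are
combinations of the first two rows of `s`), and consequently the `ω₀`-numerators are proportional:
`N₀' dN₁' − N₁' dN₀' = det(A) · (N₀ dN₁ − N₁ dN₀)` (`omegaNum_sameClass`).  With `SplitHolFormulas.push_omega0_apply`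
this gives `push s' ω₀ = (det A / λ²) · push s ω₀` within a line class.
-/

noncomputable section

open Matrix

namespace HodgeCM
namespace PerL34
namespace LineClass

open HodgeCM.PerL34.BallModel HodgeCM.PerL34.BallFrame

/-- (Ported verbatim from the HodgeCMPerL package; no docstring in the source.) -/
theorem mat_mul_mat_inv (s : U21) : mat s * mat s⁻¹ = 1 := by
  rw [← mat_mul, mul_inv_cancel, mat_one]

/-- (Ported verbatim from the HodgeCMPerL package; no docstring in the source.) -/
theorem mat_22_ne_zero (s : U21) : mat s 2 2 ≠ 0 := by
  simpa [W3_apply] using W3_2_ne_zero s x₀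

/-- Entry formula of `mat g⁻¹ = J (mat g)ᴴ J` in the corner we need: `(g⁻¹)ᵢ₂ = -Jᵢᵢ · conj (g₂ᵢ)` is
proportional to `conj (g₂ᵢ)`; we only use: `g₂ᵢ = 0 → (g⁻¹)ᵢ₂ = 0` for `i = 0, 1`. -/
theorem inv_upper_right_eq_zero (g : U21) (i : Fin 2) (h : mat g 2 (Fin.castSucc i) = 0) :
    mat g⁻¹ (Fin.castSucc i) 2 = 0 := by
  rw [mat_inv]
  fin_cases i <;> simp at h <;>
    simp [Matrix.mul_apply, Fin.sum_univ_three, J_apply_of_ne, Matrix.conjTranspose_apply, h]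

/-- **Same pole line ⇒ same plane of the other two rows.** -/
theorem rows_of_sameClass (s s' : U21) (c : ℂ) (h : ∀ j, mat s' 2 j = c * mat s 2 j) :
    ∃ A : Matrix (Fin 2) (Fin 2) ℂ,
      ∀ (i : Fin 2) (j : Fin 3), mat s' (Fin.castSucc i) j = A i 0 * mat s 0 j + A i 1 * mat s 1 j := by
  have hc : c ≠ 0 := by
    intro hc
    exact mat_22_ne_zero s' (by rw [h 2, hc, zero_mul])
  -- `k' := s * s'⁻¹` has last row `(0, 0, c⁻¹)`
  set k' : U21 := s * s'⁻¹ with hk'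
  have hrow : ∀ j, c * mat k' 2 j = (1 : Matrix (Fin 3) (Fin 3) ℂ) 2 j := by
    intro j
    rw [← mat_mul_mat_inv s', hk', mat_mul, Matrix.mul_apply, Matrix.mul_apply, Finset.mul_sum]
    refine Finset.sum_congr rfl fun m _ => ?_
    rw [h m]
    ring
  have hk'20 : mat k' 2 0 = 0 := by
    have := hrow 0
    simp only [Matrix.one_apply_ne (by decide : (2 : Fin 3) ≠ 0)] at this
    exact (mul_eq_zero.mp this).resolve_left hc
  have hk'21 : mat k' 2 1 = 0 := by
    have := hrow 1
    simp only [Matrix.one_apply_ne (by decide : (2 : Fin 3) ≠ 1)] at this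
    exact (mul_eq_zero.mp this).resolve_left hc
  -- `k := k'⁻¹ = s' * s⁻¹` has vanishing upper-right column
  have hk02 : mat k'⁻¹ 0 2 = 0 := inv_upper_right_eq_zero k' 0 hk'20
  have hk12 : mat k'⁻¹ 1 2 = 0 := inv_upper_right_eq_zero k' 1 hk'21
  have hs' : mat s' = mat k'⁻¹ * mat s := by
    rw [← mat_mul, hk', _root_.mul_inv_rev, inv_inv, inv_mul_cancel_right]
  refine ⟨Matrix.of fun i m => mat k'⁻¹ (Fin.castSucc i) (Fin.castSucc m), fun i j => ?_⟩
  rw [hs', Matrix.mul_apply, Fin.sum_univ_three]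
  fin_cases i
  · simp [hk02]
  · simp [hk12]

/-- **The `ω₀`-numerators of a line class are proportional**: with `A` as in `rows_of_sameClass`,
`N₀' s'₁ⱼ − N₁' s'₀ⱼ = det A · (N₀ s₁ⱼ − N₁ s₀ⱼ)` at every point. -/
theorem omegaNum_sameClass (s s' : U21) (c : ℂ) (h : ∀ j, mat s' 2 j = c * mat s 2 j) :
    ∃ μ : ℂ, ∀ (x : Ball) (j : Fin 2),
      W3 s' x 0 * mat s' 1 (Fin.castSucc j) - W3 s' x 1 * mat s' 0 (Fin.castSucc j) =
        μ * (W3 s x 0 * mat s 1 (Fin.castSucc j) - W3 s x 1 * mat s 0 (Fin.castSucc j)) := by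
  obtain ⟨A, hA⟩ := rows_of_sameClass s s' c h
  refine ⟨A 0 0 * A 1 1 - A 0 1 * A 1 0, fun x j => ?_⟩
  have h0 : ∀ j : Fin 3, mat s' 0 j = A 0 0 * mat s 0 j + A 0 1 * mat s 1 j := hA 0
  have h1 : ∀ j : Fin 3, mat s' 1 j = A 1 0 * mat s 0 j + A 1 1 * mat s 1 j := hA 1
  simp only [W3_apply, h0, h1]
  ring

/-- The `dz₀`-numerators of a line class stay in the pencil through `ℓ`: `ℓ' s'₀ⱼ − N₀' ℓ'ⱼ = c (ℓ Lⱼ − L ℓⱼ)` with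
the affine `L := N₀'` (a combination of `N₀, N₁`) — recorded as the trivial factorisation `ℓ' = c ℓ`. -/
theorem dzNum_sameClass (s s' : U21) (c : ℂ) (h : ∀ j, mat s' 2 j = c * mat s 2 j) (x : Ball) (j : Fin 2) :
    mat s' 0 (Fin.castSucc j) * W3 s' x 2 - W3 s' x 0 * mat s' 2 (Fin.castSucc j) =
      c * (W3 s x 2 * mat s' 0 (Fin.castSucc j) - W3 s' x 0 * mat s 2 (Fin.castSucc j)) := by
  simp only [W3_apply, h]
  ring

end LineClass
end PerL34
end HodgeCM

end

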